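import Literature.Analysis.Calculus.IntervalCauchySchwarz

/-!
# Tools A for stub `stub_radialBlock` of crux `CoreLinearInvertibility`
# (stmt-NavierStokesRegularity-17973), line `Sketch`: one-variable Hardy estimates for the radial ODE

The radial block of the even sector inverts the Gallay–Wayne operator `L = Δ + ½x·∇ + 1` on RADIAL
mass-zero vorticities `w(x) = W(|x|)` in the weighted space `X_λ = L²(G_λ⁻¹)`,
`G_λ⁻¹ ∝ e^{β r²/4}`, `β = 1 − λ ∈ (0, 1]`. In the radial variable `L` is in divergence form,
`r (Lw)(r) = J'(r)` with the FLUX `J = r W' + (r²/2) W`, and the whole estimate is one-dimensional.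
This file proves the one-variable inequalities (all integrals are interval integrals on `[0, b]`,
`b` a support radius; `N := ∫₀ᵇ e^{βr²/4} F² r dr` where `J' = r F`):

* `sq_intervalIntegral_mul_le` — Cauchy–Schwarz in squared form;
* `radial_hardy_flux` — the Gaussian-weight Hardy inequality for the flux,
  `∫₀ᵇ e^{βr²/4} J² r dr ≤ (16/β²) N` (integration by parts against `(2/β) e^{βr²/4}`, `J(0) = J(b) = 0`);
* `radial_flux_sq_le` — the pointwise bound `J(r)² ≤ (r²/2) N`;
* `radial_center_sq_le` — MASS ZERO pins the centre value: `W(0) = −∫₀ᵇ (W' + (r/2)W)`, whence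
  `W(0)² ≤ N + 2 ∫₀ᵇ e^{βr²/4} J² r`.
-/

set_option linter.dupNamespace false

noncomputable section

namespace Summit.NavierStokesRegularity.NavierStokesRegularity.Theorems

open MeasureTheory Filter Topology Set intervalIntegral

/-! ### Cauchy–Schwarz (squared form) and the Gaussian weight -/

/-- **Cauchy–Schwarz for interval integrals, squared form**: `(∫ᵤᵛ f g)² ≤ (∫ᵤᵛ f²)(∫ᵤᵛ g²)` for
`u ≤ v` and interval-integrable `f², g², fg` (discriminant of `t ↦ ∫ (tf + g)² ≥ 0`). [folklore] -/
theorem sq_intervalIntegral_mul_le {f g : ℝ → ℝ} {u v : ℝ} (huv : u ≤ v)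
    (hf : IntervalIntegrable (fun x => f x ^ 2) volume u v)
    (hg : IntervalIntegrable (fun x => g x ^ 2) volume u v)
    (hfg : IntervalIntegrable (fun x => f x * g x) volume u v) :
    (∫ x in u..v, f x * g x) ^ 2 ≤ (∫ x in u..v, f x ^ 2) * ∫ x in u..v, g x ^ 2 := by
  have hquad : ∀ t : ℝ, 0 ≤ (∫ x in u..v, f x ^ 2) * (t * t) + 2 * (∫ x in u..v, f x * g x) * t +
      ∫ x in u..v, g x ^ 2 := by
    intro t
    have i1 : IntervalIntegrable (fun x => t ^ 2 * f x ^ 2) volume u v := hf.const_mul _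
    have i2 : IntervalIntegrable (fun x => 2 * t * (f x * g x)) volume u v := hfg.const_mul _
    have heq : ∫ x in u..v, (t * f x + g x) ^ 2 =
        (∫ x in u..v, f x ^ 2) * (t * t) + 2 * (∫ x in u..v, f x * g x) * t + ∫ x in u..v, g x ^ 2 := by
      have hfun : (fun x => (t * f x + g x) ^ 2) =
          fun x => (t ^ 2 * f x ^ 2 + 2 * t * (f x * g x)) + g x ^ 2 := by
        funext x; ring
      rw [hfun, intervalIntegral.integral_add (i1.add i2) hg, intervalIntegral.integral_add i1 i2,
        intervalIntegral.integral_const_mul, intervalIntegral.integral_const_mul]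
      ring
    rw [← heq]
    exact intervalIntegral.integral_nonneg huv fun x _ => sq_nonneg _
  have hdisc := discrim_le_zero hquad
  rw [discrim] at hdisc
  nlinarith [hdisc]

/-- `d/dr e^{a r²} = 2 a r e^{a r²}`. [folklore] -/
theorem hasDerivAt_exp_mul_sq (a r : ℝ) :
    HasDerivAt (fun s => Real.exp (a * s ^ 2)) (2 * a * r * Real.exp (a * r ^ 2)) r := by
  have h : HasDerivAt (fun s : ℝ => a * s ^ 2) (a * (2 * r)) r := by
    simpa using (hasDerivAt_pow 2 r).const_mul a
  convert h.exp using 1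
  ring

/-! ### The Gaussian-weight Hardy inequality for the flux -/

/-- **Hardy inequality for the flux.** If `J ∈ C⁰` has `J' = r F` on `[0, b]` (`F` continuous) and
`J(0) = J(b) = 0`, then for `β > 0`
`∫₀ᵇ e^{βr²/4} J² r dr ≤ (16/β²) ∫₀ᵇ e^{βr²/4} F² r dr`
(integrate by parts against `r e^{βr²/4} = ((2/β) e^{βr²/4})'`, then `2|JF| ≤ (β/4)J² + (4/β)F²`). [folklore] -/
theorem radial_hardy_flux {β b : ℝ} (hβ : 0 < β) (hb : 0 ≤ b) {J F : ℝ → ℝ}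
    (hJc : Continuous J) (hFc : Continuous F)
    (hJ' : ∀ r ∈ Icc 0 b, HasDerivAt J (r * F r) r) (hJ0 : J 0 = 0) (hJb : J b = 0) :
    ∫ r in 0..b, Real.exp (β / 4 * r ^ 2) * J r ^ 2 * r ≤
      16 / β ^ 2 * ∫ r in 0..b, Real.exp (β / 4 * r ^ 2) * F r ^ 2 * r := by
  have hβ0 : β ≠ 0 := hβ.ne'
  have hE : ∀ r, HasDerivAt (fun s => 2 / β * Real.exp (β / 4 * s ^ 2))
      (r * Real.exp (β / 4 * r ^ 2)) r := by
    intro r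
    refine ((hasDerivAt_exp_mul_sq (β / 4) r).const_mul (2 / β)).congr_deriv ?_
    field_simp
    ring
  have hJ2 : ∀ r ∈ uIcc 0 b, HasDerivAt (fun s => J s ^ 2) (2 * J r * (r * F r)) r := by
    intro r hr
    rw [uIcc_of_le hb] at hr
    simpa using (hJ' r hr).fun_pow 2
  have hEc : Continuous fun r : ℝ => Real.exp (β / 4 * r ^ 2) :=
    Real.continuous_exp.comp (continuous_const.mul (continuous_id.pow 2))
  have hibp := intervalIntegral.integral_mul_deriv_eq_deriv_mul hJ2 (fun r _ => hE r)
    (((continuous_const.mul hJc).mul (continuous_id.mul hFc)).intervalIntegrable _ _)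
    ((continuous_id.mul hEc).intervalIntegrable _ _)
  simp only [hJ0, hJb] at hibp
  have hlhs : ∫ r in 0..b, Real.exp (β / 4 * r ^ 2) * J r ^ 2 * r =
      ∫ r in 0..b, J r ^ 2 * (r * Real.exp (β / 4 * r ^ 2)) :=
    intervalIntegral.integral_congr fun r _ => by ring
  rw [hlhs, hibp]
  have hmono : -∫ r in 0..b, 2 * J r * (r * F r) * (2 / β * Real.exp (β / 4 * r ^ 2)) ≤
      ∫ r in 0..b, ((1 / 2) * (J r ^ 2 * (r * Real.exp (β / 4 * r ^ 2))) +
        16 / β ^ 2 / 2 * (Real.exp (β / 4 * r ^ 2) * F r ^ 2 * r)) := by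
    rw [← intervalIntegral.integral_neg]
    refine intervalIntegral.integral_mono_on hb ?_ ?_ fun r hr => ?_
    · exact ((((continuous_const.mul hJc).mul (continuous_id.mul hFc)).mul
        (continuous_const.mul hEc)).neg).intervalIntegrable _ _
    · exact ((continuous_const.mul ((hJc.pow 2).mul (continuous_id.mul hEc))).add
        (continuous_const.mul ((hEc.mul (hFc.pow 2)).mul continuous_id))).intervalIntegrable _ _
    · have he : 0 ≤ Real.exp (β / 4 * r ^ 2) := (Real.exp_pos _).le
      have h0 : 0 ≤ r * Real.exp (β / 4 * r ^ 2) * (J r + 4 / β * F r) ^ 2 := by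
        have := hr.1; positivity
      have e : (1 / 2) * (J r ^ 2 * (r * Real.exp (β / 4 * r ^ 2))) +
          16 / β ^ 2 / 2 * (Real.exp (β / 4 * r ^ 2) * F r ^ 2 * r) -
          -(2 * J r * (r * F r) * (2 / β * Real.exp (β / 4 * r ^ 2))) =
          (1 / 2) * (r * Real.exp (β / 4 * r ^ 2) * (J r + 4 / β * F r) ^ 2) := by
        field_simp
        ring
      linarith
  rw [intervalIntegral.integral_add, intervalIntegral.integral_const_mul,
    intervalIntegral.integral_const_mul] at hmono
  · linarith
  · exact (continuous_const.mul ((hJc.pow 2).mul (continuous_id.mul hEc))).intervalIntegrable _ _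
  · exact (continuous_const.mul ((hEc.mul (hFc.pow 2)).mul continuous_id)).intervalIntegrable _ _


/-! ### The pointwise flux bound -/

/-- **Pointwise flux bound**: if `J' = rF` on `[0, b]` and `J(0) = 0`, then for `r ∈ [0, b]`
`J(r)² = (∫₀ʳ s F)² ≤ (r²/2) ∫₀ᵇ e^{βs²/4} F² s` (Cauchy–Schwarz with `√s · √s F`). [folklore] -/
theorem radial_flux_sq_le {β b : ℝ} (hβ : 0 ≤ β) {J F : ℝ → ℝ} (hFc : Continuous F)
    (hJ' : ∀ r ∈ Icc 0 b, HasDerivAt J (r * F r) r) (hJ0 : J 0 = 0) {r : ℝ} (hr : r ∈ Icc 0 b) :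
    J r ^ 2 ≤ r ^ 2 / 2 * ∫ s in 0..b, Real.exp (β / 4 * s ^ 2) * F s ^ 2 * s := by
  have hEc : Continuous fun s : ℝ => Real.exp (β / 4 * s ^ 2) :=
    Real.continuous_exp.comp (continuous_const.mul (continuous_id.pow 2))
  -- FTC on `[0, r]`
  have hftc : ∫ s in 0..r, s * F s = J r := by
    have h := integral_eq_sub_of_hasDerivAt (f := J) (f' := fun s => s * F s) (a := 0) (b := r)
      (fun s hs => by
        rw [uIcc_of_le hr.1] at hs
        exact hJ' s ⟨hs.1, hs.2.trans hr.2⟩)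
      ((continuous_id.mul hFc).intervalIntegrable _ _)
    rw [h, hJ0, sub_zero]
  -- Cauchy–Schwarz with `√s` and `√s F`
  have hcs := sq_intervalIntegral_mul_le hr.1 (f := fun s => Real.sqrt s) (g := fun s => Real.sqrt s * F s)
    ((Real.continuous_sqrt.pow 2).intervalIntegrable _ _)
    (((Real.continuous_sqrt.mul hFc).pow 2).intervalIntegrable _ _)
    ((Real.continuous_sqrt.mul (Real.continuous_sqrt.mul hFc)).intervalIntegrable _ _)
  have e1 : ∫ s in 0..r, Real.sqrt s * (Real.sqrt s * F s) = ∫ s in 0..r, s * F s := by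
    refine intervalIntegral.integral_congr fun s hs => ?_
    rw [uIcc_of_le hr.1] at hs
    show Real.sqrt s * (Real.sqrt s * F s) = s * F s
    rw [← mul_assoc, Real.mul_self_sqrt hs.1]
  have e2 : ∫ s in 0..r, Real.sqrt s ^ 2 = r ^ 2 / 2 := by
    have : ∫ s in 0..r, Real.sqrt s ^ 2 = ∫ s in 0..r, s := by
      refine intervalIntegral.integral_congr fun s hs => ?_
      rw [uIcc_of_le hr.1] at hs
      exact Real.sq_sqrt hs.1
    rw [this, integral_id]
    ring
  have e3 : ∫ s in 0..r, (Real.sqrt s * F s) ^ 2 ≤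
      ∫ s in 0..b, Real.exp (β / 4 * s ^ 2) * F s ^ 2 * s := by
    have h1 : ∫ s in 0..r, (Real.sqrt s * F s) ^ 2 = ∫ s in 0..r, s * F s ^ 2 := by
      refine intervalIntegral.integral_congr fun s hs => ?_
      rw [uIcc_of_le hr.1] at hs
      show (Real.sqrt s * F s) ^ 2 = s * F s ^ 2
      rw [mul_pow, Real.sq_sqrt hs.1]
    rw [h1]
    calc ∫ s in 0..r, s * F s ^ 2 ≤ ∫ s in 0..r, Real.exp (β / 4 * s ^ 2) * F s ^ 2 * s := by
          refine intervalIntegral.integral_mono_on hr.1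
            ((continuous_id.mul (hFc.pow 2)).intervalIntegrable _ _)
            (((hEc.mul (hFc.pow 2)).mul continuous_id).intervalIntegrable _ _) fun s hs => ?_
          have h1 : (1 : ℝ) ≤ Real.exp (β / 4 * s ^ 2) := Real.one_le_exp (by positivity)
          have h2 : 0 ≤ s * F s ^ 2 := mul_nonneg hs.1 (sq_nonneg _)
          nlinarith
      _ ≤ ∫ s in 0..b, Real.exp (β / 4 * s ^ 2) * F s ^ 2 * s := by
          refine intervalIntegral.integral_mono_interval le_rfl hr.1 hr.2 ?_
            (((hEc.mul (hFc.pow 2)).mul continuous_id).intervalIntegrable _ _)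
          filter_upwards [ae_restrict_mem measurableSet_Ioc] with s hs
          exact mul_nonneg (mul_nonneg (Real.exp_pos _).le (sq_nonneg _)) hs.1.le
  rw [e1, hftc, e2] at hcs
  calc J r ^ 2 ≤ r ^ 2 / 2 * ∫ s in 0..r, (Real.sqrt s * F s) ^ 2 := hcs
    _ ≤ _ := mul_le_mul_of_nonneg_left e3 (by positivity)

/-! ### Mass zero pins the centre value -/

/-- **The centre value of a mass-zero radial profile.** If `W' = W₁`, `W(b) = 0`,
`∫₀ᵇ W r dr = 0` (zero mass) and the flux `J = rW₁ + (r²/2)W` obeys `J² ≤ (r²/2) N` on `[0, b]`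
(`b ≥ 1`), then `W(0) = −∫₀ᵇ (W₁ + (r/2)W)` and
`W(0)² ≤ N + 2 ∫₀ᵇ e^{βr²/4} J² r` (split at `r = 1`; Cauchy–Schwarz against `1` and against `1/r`). [folklore] -/
theorem radial_center_sq_le {β b N : ℝ} (hβ : 0 ≤ β) (hb : 1 ≤ b) {W W₁ J : ℝ → ℝ}
    (hW : ∀ r, HasDerivAt W (W₁ r) r) (hW₁c : Continuous W₁) (hJc : Continuous J)
    (hJ : ∀ r, J r = r * W₁ r + r ^ 2 / 2 * W r)
    (hJsq : ∀ r ∈ Icc 0 b, J r ^ 2 ≤ r ^ 2 / 2 * N)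
    (hWb : W b = 0) (hmass : ∫ r in 0..b, W r * r = 0) :
    W 0 ^ 2 ≤ N + 2 * ∫ r in 0..b, Real.exp (β / 4 * r ^ 2) * J r ^ 2 * r := by
  have hb0 : (0 : ℝ) ≤ b := zero_le_one.trans hb
  have hEc : Continuous fun s : ℝ => Real.exp (β / 4 * s ^ 2) :=
    Real.continuous_exp.comp (continuous_const.mul (continuous_id.pow 2))
  have hWc : Continuous W := continuous_iff_continuousAt.2 fun r => (hW r).continuousAt
  set q : ℝ → ℝ := fun r => W₁ r + r / 2 * W r with hq
  have hqc : Continuous q := hW₁c.add ((continuous_id.div_const 2).mul hWc)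
  -- `W 0 = -∫ q`
  have h0 : W 0 = -∫ r in 0..b, q r := by
    have h1 : ∫ r in 0..b, W₁ r = W b - W 0 :=
      integral_eq_sub_of_hasDerivAt (fun r _ => hW r) (hW₁c.intervalIntegrable _ _)
    have h2 : ∫ r in 0..b, q r = (∫ r in 0..b, W₁ r) + ∫ r in 0..b, r / 2 * W r :=
      intervalIntegral.integral_add (hW₁c.intervalIntegrable _ _)
        (((continuous_id.div_const 2).mul hWc).intervalIntegrable _ _)
    have h3 : ∫ r in 0..b, r / 2 * W r = 1 / 2 * ∫ r in 0..b, W r * r := by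
      rw [← intervalIntegral.integral_const_mul]
      exact intervalIntegral.integral_congr fun r _ => by ring
    rw [h2, h1, h3, hmass, hWb]
    ring
  have hsplit : ∫ r in 0..b, q r = (∫ r in 0..1, q r) + ∫ r in 1..b, q r :=
    (intervalIntegral.integral_add_adjacent_intervals (hqc.intervalIntegrable _ _)
      (hqc.intervalIntegrable _ _)).symm
  have hq_sq : ∀ r ∈ Ioo 0 b, q r ^ 2 ≤ N / 2 := by
    intro r hr
    have hJr : J r = r * q r := by rw [hJ]; simp only [hq]; ring
    have h := hJsq r ⟨hr.1.le, hr.2.le⟩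
    rw [hJr, mul_pow] at h
    have hr2 : 0 < r ^ 2 := by have := hr.1; positivity
    exact le_of_mul_le_mul_left (by linarith) hr2
  -- near part `[0, 1]`
  have hI1 : (∫ r in 0..1, q r) ^ 2 ≤ N / 2 := by
    have hcs := sq_intervalIntegral_mul_le zero_le_one (f := fun _ => (1 : ℝ)) (g := q)
      intervalIntegrable_const ((hqc.pow 2).intervalIntegrable _ _)
      ((continuous_const.mul hqc).intervalIntegrable _ _)
    have h1c : ∫ r in (0 : ℝ)..1, (fun _ => (1 : ℝ)) r ^ 2 = 1 := by simp
    have h1m : ∫ r in (0 : ℝ)..1, (fun _ => (1 : ℝ)) r * q r = ∫ r in (0 : ℝ)..1, q r :=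
      intervalIntegral.integral_congr fun r _ => one_mul _
    rw [h1c, h1m, one_mul] at hcs
    have h2 : ∫ r in 0..1, q r ^ 2 ≤ ∫ r in (0 : ℝ)..1, N / 2 :=
      intervalIntegral.integral_mono_on_of_le_Ioo zero_le_one ((hqc.pow 2).intervalIntegrable _ _)
        intervalIntegrable_const fun r hr => hq_sq r ⟨hr.1, hr.2.trans_le hb⟩
    rw [intervalIntegral.integral_const, sub_zero, smul_eq_mul, one_mul] at h2
    exact hcs.trans h2
  -- far part `[1, b]`
  have hI2 : (∫ r in 1..b, q r) ^ 2 ≤ ∫ r in 0..b, Real.exp (β / 4 * r ^ 2) * J r ^ 2 * r := by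
    have e1 : ∫ r in 1..b, q r = ∫ r in 1..b, J r * r⁻¹ := by
      refine intervalIntegral.integral_congr fun r hr => ?_
      rw [uIcc_of_le hb] at hr
      have hr0 : r ≠ 0 := (zero_lt_one.trans_le hr.1).ne'
      show q r = J r * r⁻¹
      rw [hJ]
      simp only [hq]
      field_simp
    have hinv_c : ContinuousOn (fun r : ℝ => r⁻¹) (uIcc 1 b) := by
      rw [uIcc_of_le hb]
      exact continuousOn_inv₀.mono fun r hr => (zero_lt_one.trans_le hr.1).ne'
    have hinv2_c : ContinuousOn (fun r : ℝ => r⁻¹ ^ 2) (uIcc 1 b) := hinv_c.pow 2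
    have hcs := sq_intervalIntegral_mul_le hb (f := J) (g := fun r => r⁻¹)
      ((hJc.pow 2).intervalIntegrable _ _) hinv2_c.intervalIntegrable
      (hJc.continuousOn.mul hinv_c).intervalIntegrable
    have hi : ∫ r in 1..b, r⁻¹ ^ 2 ≤ 1 := by
      have hd : ∀ r ∈ uIcc 1 b, HasDerivAt (fun s : ℝ => -s⁻¹) (r⁻¹ ^ 2) r := by
        intro r hr
        rw [uIcc_of_le hb] at hr
        have hr0 : r ≠ 0 := (zero_lt_one.trans_le hr.1).ne'
        simpa [inv_pow] using (hasDerivAt_inv hr0).fun_neg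
      rw [integral_eq_sub_of_hasDerivAt hd hinv2_c.intervalIntegrable]
      have : 0 ≤ b⁻¹ := inv_nonneg.2 hb0
      simp only [inv_one]
      linarith
    have hJ2 : ∫ r in 1..b, J r ^ 2 ≤ ∫ r in 0..b, Real.exp (β / 4 * r ^ 2) * J r ^ 2 * r := by
      calc ∫ r in 1..b, J r ^ 2 ≤ ∫ r in 1..b, Real.exp (β / 4 * r ^ 2) * J r ^ 2 * r := by
            refine intervalIntegral.integral_mono_on hb ((hJc.pow 2).intervalIntegrable _ _)
              (((hEc.mul (hJc.pow 2)).mul continuous_id).intervalIntegrable _ _) fun r hr => ?_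
            have h1 : (1 : ℝ) ≤ Real.exp (β / 4 * r ^ 2) := Real.one_le_exp (by positivity)
            have h1' : (1 : ℝ) ≤ Real.exp (β / 4 * r ^ 2) * r := by nlinarith [hr.1]
            nlinarith [sq_nonneg (J r)]
        _ ≤ ∫ r in 0..b, Real.exp (β / 4 * r ^ 2) * J r ^ 2 * r := by
            refine intervalIntegral.integral_mono_interval zero_le_one hb le_rfl ?_
              (((hEc.mul (hJc.pow 2)).mul continuous_id).intervalIntegrable _ _)
            filter_upwards [ae_restrict_mem measurableSet_Ioc] with s hs
            exact mul_nonneg (mul_nonneg (Real.exp_pos _).le (sq_nonneg _)) hs.1.le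
    have h0' : 0 ≤ ∫ r in 1..b, J r ^ 2 := intervalIntegral.integral_nonneg hb fun r _ => sq_nonneg _
    calc (∫ r in 1..b, q r) ^ 2 = (∫ r in 1..b, J r * r⁻¹) ^ 2 := by rw [e1]
      _ ≤ (∫ r in 1..b, J r ^ 2) * ∫ r in 1..b, r⁻¹ ^ 2 := hcs
      _ ≤ (∫ r in 1..b, J r ^ 2) * 1 := mul_le_mul_of_nonneg_left hi h0'
      _ ≤ _ := by rw [mul_one]; exact hJ2
  rw [h0, hsplit]
  nlinarith [hI1, hI2, sq_nonneg ((∫ r in 0..1, q r) - ∫ r in 1..b, q r)]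


/-- Registered tools stub of crux stmt-NavierStokesRegularity-17973 (`stub_radialBlockToolsA`):
one-variable Hardy estimates for the radial flux ODE `J' = rF`, `J = rW₁ + (r²/2)W` — Cauchy–Schwarz
(squared form), the Gaussian-weight Hardy inequality for the flux, the pointwise flux bound, and the
centre value pinned by zero mass. [folklore] -/
theorem stub_radialBlockToolsA :
    (∀ (f g : ℝ → ℝ) (u v : ℝ), u ≤ v → IntervalIntegrable (fun x => f x ^ 2) volume u v →
      IntervalIntegrable (fun x => g x ^ 2) volume u v → IntervalIntegrable (fun x => f x * g x) volume u v →
      (∫ x in u..v, f x * g x) ^ 2 ≤ (∫ x in u..v, f x ^ 2) * ∫ x in u..v, g x ^ 2) ∧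
    (∀ (β b : ℝ) (J F : ℝ → ℝ), 0 < β → 0 ≤ b → Continuous J → Continuous F →
      (∀ r ∈ Set.Icc 0 b, HasDerivAt J (r * F r) r) → J 0 = 0 → J b = 0 →
      ∫ r in 0..b, Real.exp (β / 4 * r ^ 2) * J r ^ 2 * r ≤
        16 / β ^ 2 * ∫ r in 0..b, Real.exp (β / 4 * r ^ 2) * F r ^ 2 * r) ∧
    (∀ (β b : ℝ) (J F : ℝ → ℝ), 0 ≤ β → Continuous F → (∀ r ∈ Set.Icc 0 b, HasDerivAt J (r * F r) r) →
      J 0 = 0 → ∀ r ∈ Set.Icc 0 b,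
      J r ^ 2 ≤ r ^ 2 / 2 * ∫ s in 0..b, Real.exp (β / 4 * s ^ 2) * F s ^ 2 * s) ∧
    (∀ (β b N : ℝ) (W W₁ J : ℝ → ℝ), 0 ≤ β → 1 ≤ b → (∀ r, HasDerivAt W (W₁ r) r) → Continuous W₁ →
      Continuous J → (∀ r, J r = r * W₁ r + r ^ 2 / 2 * W r) →
      (∀ r ∈ Set.Icc 0 b, J r ^ 2 ≤ r ^ 2 / 2 * N) → W b = 0 → ∫ r in 0..b, W r * r = 0 →
      W 0 ^ 2 ≤ N + 2 * ∫ r in 0..b, Real.exp (β / 4 * r ^ 2) * J r ^ 2 * r) :=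
  ⟨fun _ _ _ _ huv hf hg hfg => sq_intervalIntegral_mul_le huv hf hg hfg,
    fun _ _ _ _ hβ hb hJc hFc hJ' hJ0 hJb => radial_hardy_flux hβ hb hJc hFc hJ' hJ0 hJb,
    fun _ _ _ _ hβ hFc hJ' hJ0 _ hr => radial_flux_sq_le hβ hFc hJ' hJ0 hr,
    fun _ _ _ _ _ _ hβ hb hW hW₁c hJc hJ hJsq hWb hmass =>
      radial_center_sq_le hβ hb hW hW₁c hJc hJ hJsq hWb hmass⟩

end Summit.NavierStokesRegularity.NavierStokesRegularity.Theorems
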